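import Literature.NumberTheory.GaloisRepresentations.EisensteinSexticPlaces
import HarnessLib

/-!
# The Größencharakter `𝔭 ↦ (N𝔭/|u|)·(u/𝔭)₃·ϖ_𝔭` of `ℚ(ω)` modulo `(9u)` — the Hecke character of `y² = x³ + 16u`, `u ≡ 1 (mod 4)`
# (the good-at-`2` sextic twists; Ireland–Rosen Ch. 18 §§3–7)

Topic `Literature/NumberTheory/GaloisRepresentations`, namespace `Literature.NumberTheory.GaloisRepresentations.EisensteinSextic` (sequel of
`EisensteinSexticHeckeCharacter`).  Definitions with bodies (`modulusOdd`, `psiOdd`) and THEOREMS; no instance, no notation, no named fact.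
For `k = 16u` with `u ≡ 1 (mod 4)` the curve `E^k : y² = x³ + k` has good (supersingular) reduction at `2` (`y² + y = x³ + (u−1)/4`), so the
modulus `(36k)` of `EisensteinSexticHeckeCharacter.psi` is too large at `2`.  Since `(16u/p) = (u/p) = (p/|u|)` (quadratic reciprocity for
`u ≡ 1 (4)`) and `(64u/𝔭)₃ = (u/𝔭)₃`, the same Größencharakter is, on the primes `𝔭 ∤ 3u` of `K = ℚ(ω)`,

  `psiOdd hζ u e v = [3u ∈ 𝔭_v ↦ 0] · (N𝔭_v / |u|) · e((u/𝔭_v)₃) · e(ϖ_v)`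

(Jacobi symbol with the NORM ON TOP), a Größencharakter modulo the ODD ideal `(9u)`:

* `modulusOdd u = (9u)`, `modulusOdd_le_iff` (`(9u) ∣ 𝔭 ↔ 3u ∈ 𝔭`), `gcd_absNorm_eq_one'`; `psiOdd`, `psiOdd_ne_zero`;
* `idealPow_jacobiSym_left` (`∏ (N𝔭/n)^{ν_𝔭(𝔞)} = (N𝔞/n)`, `jacobiSym.mul_left`), ★ `idealPow_psiOdd_span`;
* ★★ `isGrossencharakter_psiOdd : IsGrossencharakter (9u) (embType e) (embTypeConj e) (psiOdd hζ u e)` (`u ≠ 0`; quadratic part by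
  `absNorm_span_modEq` + `jacobiSym.mod_left`, cubic part modulo `9u`, generator part modulo `3`), its literal type-`(1,0)` form
  `isGrossencharakter_psiOdd_one_zero`, and ★ `psiOdd_smul_eq_conj`.

The Frobenius values (including `p = 2`) and the datum are in `EllipticCurves/SexticTwistGrossencharakterFrobeniusGoodTwo`.  Nothing about BSD
is proved here; no modularity is used.

## References
* K. Ireland, M. Rosen, *A Classical Introduction to Modern Number Theory*, 2nd ed., GTM 84 (1990), Ch. 18 §3 Theorem 4, §4 Theorem 5 (the
  conductor at `2`), §6 Theorem 7, §7; Ch. 5 §2 (quadratic reciprocity). [IrelandRosen1990]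
* J. Neukirch, *Algebraic Number Theory* (1999), Ch. VII §6 Def. (6.1), Cor. (6.14). [NeukirchANT1999]
* J. H. Silverman, *Advanced Topics in the Arithmetic of Elliptic Curves* (1994), II Thm. 9.2, Thm. 10.5. [SilvermanATAEC1994]

## Mathlib / tree search
Tree: `EisensteinSextic.{cubicLoc, varpi, hsurj_three, hinj_three, absNorm_span_modEq, natCast_absNorm_span, coe_cubicLoc_smul, embedding_varpi_smul,
intCast_mem_smul_iff, smul_intCast, absNorm_smul, subsingleton_infinitePlace, artinSymbol_cubicLoc_span_eq_of_sub_mem, varpi_ne_zero}`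
(`EisensteinSexticPrimes`), the `(36k)` twin `EisensteinSexticHeckeCharacter` (`psi`, `idealPow_psi_span`, `isGrossencharakter_psi`);
`idealPow_primaryGen_span`, `primarize_mul_eq_primarize_mul`, `prod_embedding_zpow_embType` (`PrimaryGeneratorHeckeCharacter`); `IsGrossencharakter`;
`LFunctions.{idealPow, idealPow_finsuppProd, mem_range_finsuppProd_asIdeal_pow_iff, isCoprime_span_of_sub_mem, isCoprime_iff_forall_not_le, mulSupport_idealPow_finite}`,
`LFunctions.AbelianDensity.idealPow_comp_eq`.  Mathlib: `jacobiSym.{mod_left, mul_left, one_left, eq_zero_iff}`, `map_finsuppProd`.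
-/

noncomputable section

open NumberField IsDedekindDomain IsDedekindDomain.HeightOneSpectrum
open scoped NumberTheorySymbols ComplexConjugate Pointwise

namespace Literature.NumberTheory.GaloisRepresentations.EisensteinSextic

open Literature.NumberTheory.GaloisRepresentations
open Literature.NumberTheory.LFunctions (idealPow isCoprime_span_of_sub_mem)
open Literature.NumberTheory.LFunctions.AbelianDensity (artinSymbol artinSymbol_asIdeal idealPow_comp_eq)
open Literature.NumberTheory.Automorphic (RingOfIntegers.coe_algEquiv_smul HeightOneSpectrum.smul_mem_smul_asIdeal_iff)

variable {K : Type*} [Field K] [NumberField K] {ζ : 𝓞 K} (hζ : IsPrimitiveRoot ζ 3)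

/-! ### §1 The odd modulus `(9u)` -/

section ModulusOdd

/-- The modulus `(9u)` of the good-at-`2` character. [cite: IrelandRosen1990, Ch. 18 §6 Theorem 7] -/
def modulusOdd (u : ℤ) : Ideal (𝓞 K) := Ideal.span {((9 * u : ℤ) : 𝓞 K)}

/-- `(9u) ≠ 0` for `u ≠ 0`. [cite: IrelandRosen1990, Ch. 18 §6 Theorem 7] -/
theorem modulusOdd_ne_bot {u : ℤ} (hu : u ≠ 0) : modulusOdd (K := K) u ≠ ⊥ := by
  rw [modulusOdd, Ne, Ideal.span_singleton_eq_bot]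
  exact_mod_cast (mul_ne_zero (by norm_num : (9 : ℤ) ≠ 0) hu)

omit [NumberField K] in
/-- `3u ∉ 𝔭 ⇒ 3 ∉ 𝔭, u ∉ 𝔭`. [cite: IrelandRosen1990, Ch. 18 §7] -/
theorem not_mem_of_three_mul_not_mem {u : ℤ} {v : HeightOneSpectrum (𝓞 K)} (h : ((3 * u : ℤ) : 𝓞 K) ∉ v.asIdeal) :
    (3 : 𝓞 K) ∉ v.asIdeal ∧ ((u : ℤ) : 𝓞 K) ∉ v.asIdeal := by
  refine ⟨fun h3 => h ?_, fun hu => h ?_⟩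
  · rw [show ((3 * u : ℤ) : 𝓞 K) = 3 * ((u : ℤ) : 𝓞 K) by push_cast; ring]; exact v.asIdeal.mul_mem_right _ h3
  · rw [show ((3 * u : ℤ) : 𝓞 K) = 3 * ((u : ℤ) : 𝓞 K) by push_cast; ring]; exact v.asIdeal.mul_mem_left _ hu

omit [NumberField K] in
/-- **`(9u) ∣ 𝔭 ↔ 3u ∈ 𝔭`**. [cite: IrelandRosen1990, Ch. 18 §6 Theorem 7] -/
theorem modulusOdd_le_iff (u : ℤ) (v : HeightOneSpectrum (𝓞 K)) : modulusOdd u ≤ v.asIdeal ↔ ((3 * u : ℤ) : 𝓞 K) ∈ v.asIdeal := by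
  rw [modulusOdd, Ideal.span_singleton_le_iff_mem, show ((9 * u : ℤ) : 𝓞 K) = 3 * ((3 * u : ℤ) : 𝓞 K) by push_cast; ring]
  constructor
  · intro h
    rcases v.isPrime.mem_or_mem h with h3 | h3u
    · rw [show ((3 * u : ℤ) : 𝓞 K) = 3 * ((u : ℤ) : 𝓞 K) by push_cast; ring]; exact v.asIdeal.mul_mem_right _ h3
    · exact h3u
  · intro h; exact v.asIdeal.mul_mem_left _ h

/-- `(N𝔭, u) = 1` off `3u`: `N𝔭 = p^f` for the rational prime `p ∈ 𝔭`, and `p ∣ u` would put `u` in `𝔭`. [cite: IrelandRosen1990, Ch. 18 §7] -/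
theorem gcd_absNorm_eq_one' {u : ℤ} {v : HeightOneSpectrum (𝓞 K)} (h : ((3 * u : ℤ) : 𝓞 K) ∉ v.asIdeal) :
    (Ideal.absNorm v.asIdeal : ℤ).gcd u = 1 := by
  -- reduce to the `(36k)`-lemma when `2 ∉ 𝔭`; at the prime `(2)` use `N = 4`... instead argue directly with the prime below `v`
  rw [Int.gcd_comm]
  by_cases h2 : ((6 * u : ℤ) : 𝓞 K) ∈ v.asIdeal
  · -- then `2 ∈ 𝔭` (as `3u ∉ 𝔭`), the prime below is `2`, and `2 ∤ u`
    have h2' : (2 : 𝓞 K) ∈ v.asIdeal := by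
      rw [show ((6 * u : ℤ) : 𝓞 K) = 2 * ((3 * u : ℤ) : 𝓞 K) by push_cast; ring] at h2
      rcases v.isPrime.mem_or_mem h2 with h2'' | h3u
      · exact h2''
      · exact absurd h3u h
    have hu2 : ¬ (2 : ℤ) ∣ u := by
      rintro ⟨m, rfl⟩
      apply h
      rw [show ((3 * (2 * m) : ℤ) : 𝓞 K) = 2 * ((3 * m : ℤ) : 𝓞 K) by push_cast; ring]
      exact v.asIdeal.mul_mem_right _ h2'
    haveI := Fact.mk Nat.prime_two
    haveI : v.asIdeal.LiesOver (Ideal.span {((2 : ℕ) : ℤ)}) := by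
      rw [Ideal.liesOver_iff]
      refine Ideal.IsMaximal.eq_of_le (Int.ideal_span_isMaximal_of_prime 2) Ideal.IsPrime.ne_top' ?_
      rw [Ideal.span_singleton_le_iff_mem, Ideal.mem_comap, algebraMap_int_eq, map_natCast]
      exact_mod_cast h2'
    have hN : Ideal.absNorm v.asIdeal = 2 ^ v.asIdeal.inertiaDeg ℤ := (Ideal.pow_inertiaDeg 2 v.asIdeal).symm
    rw [hN, Nat.cast_pow]
    refine Int.isCoprime_iff_gcd_eq_one.mp (IsCoprime.pow_right ?_)
    exact (Int.prime_two.coprime_iff_not_dvd.mpr hu2).symm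
  · exact gcd_absNorm_eq_one h2

end ModulusOdd

/-! ### §2 The character `ψ'(𝔭) = (N𝔭/|u|)·(u/𝔭)₃·ϖ_𝔭` and its Größencharakter property modulo `(9u)` -/

section PsiOdd

variable [IsCyclotomicExtension {3} ℚ K]

open Classical in
/-- ★ **The good-at-`2` sextic character**: `ψ'(𝔭_v) = (N𝔭_v/|u|) · e((u/𝔭_v)₃) · e(ϖ_v)` off `3u`, `0` at the primes of `3u` — the Hecke character of
`y² = x³ + 16u`, `u ≡ 1 (4)` (`(16u/p) = (p/|u|)`, `(64u/𝔭)₃ = (u/𝔭)₃`). [cite: IrelandRosen1990, Ch. 18 §3 Theorem 4, §4 Theorem 5, §7] -/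
def psiOdd (u : ℤ) (e : K →+* ℂ) (v : HeightOneSpectrum (𝓞 K)) : ℂ :=
  if ((3 * u : ℤ) : 𝓞 K) ∈ v.asIdeal then 0 else
    (J(Ideal.absNorm v.asIdeal | u.natAbs) : ℂ) * (cubicLoc hζ ((u : ℤ) : 𝓞 K) e v : ℂ) * e (varpi hζ v : K)

/-- `ψ'(𝔭) = 0` at the primes of `3u`. [cite: IrelandRosen1990, Ch. 18 §7] -/
theorem psiOdd_of_mem {u : ℤ} (e : K →+* ℂ) {v : HeightOneSpectrum (𝓞 K)} (h : ((3 * u : ℤ) : 𝓞 K) ∈ v.asIdeal) : psiOdd hζ u e v = 0 := by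
  rw [psiOdd, if_pos h]

/-- `ψ'(𝔭) = (N𝔭/|u|)·(u/𝔭)₃·ϖ_𝔭` off `3u`. [cite: IrelandRosen1990, Ch. 18 §3 Theorem 4] -/
theorem psiOdd_of_not_mem {u : ℤ} (e : K →+* ℂ) {v : HeightOneSpectrum (𝓞 K)} (h : ((3 * u : ℤ) : 𝓞 K) ∉ v.asIdeal) :
    psiOdd hζ u e v = (J(Ideal.absNorm v.asIdeal | u.natAbs) : ℂ) * (cubicLoc hζ ((u : ℤ) : 𝓞 K) e v : ℂ) * e (varpi hζ v : K) := by
  rw [psiOdd, if_neg h]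

/-- ★ `ψ'(𝔭) ≠ 0` off `3u`. [cite: IrelandRosen1990, Ch. 18 §7] -/
theorem psiOdd_ne_zero {u : ℤ} (e : K →+* ℂ) {v : HeightOneSpectrum (𝓞 K)} (h : ((3 * u : ℤ) : 𝓞 K) ∉ v.asIdeal) : psiOdd hζ u e v ≠ 0 := by
  obtain ⟨h3, -⟩ := not_mem_of_three_mul_not_mem h
  rw [psiOdd_of_not_mem hζ e h]
  refine mul_ne_zero (mul_ne_zero ?_ (Units.ne_zero _)) ?_
  · have hJ : J(Ideal.absNorm v.asIdeal | u.natAbs) ≠ 0 := fun h0 => by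
      have h1 := (jacobiSym.eq_zero_iff.mp h0).2
      have hg := gcd_absNorm_eq_one' h
      simp only [Int.gcd_eq_natAbs, Int.natAbs_natCast] at h1 hg
      exact h1 hg
    exact_mod_cast hJ
  · rw [map_ne_zero]
    exact fun h0 => varpi_ne_zero hζ h3 (by exact_mod_cast h0)

omit [IsCyclotomicExtension {3} ℚ K] in
/-- The Jacobi symbol of a finite product in its upper argument. [folklore] -/
private theorem jacobiSym_prod_left {ι : Type*} (s : Finset ι) (f : ι → ℤ) (b : ℕ) :
    J(∏ i ∈ s, f i | b) = ∏ i ∈ s, J(f i | b) := by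
  induction s using Finset.cons_induction with
  | empty => simp [jacobiSym.one_left]
  | cons i s hi ih => rw [Finset.prod_cons, Finset.prod_cons, jacobiSym.mul_left, ih]

omit [IsCyclotomicExtension {3} ℚ K] in
/-- **`∏_𝔭 (N𝔭/n)^{ν_𝔭(𝔞)} = (N𝔞/n)`** (multiplicativity of `N` and of the Jacobi symbol in its upper argument). [cite: IrelandRosen1990, Ch. 18 §6, proof of Theorem 7] -/
theorem idealPow_jacobiSym_left (n : ℕ) {I : Ideal (𝓞 K)} (hI : I ≠ ⊥) :
    idealPow K (fun v ↦ (J(Ideal.absNorm v.asIdeal | n) : ℂ)) I = (J(Ideal.absNorm I | n) : ℂ) := by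
  obtain ⟨g, rfl⟩ := (LFunctions.mem_range_finsuppProd_asIdeal_pow_iff (I := I)).mpr hI
  rw [LFunctions.idealPow_finsuppProd, map_finsuppProd Ideal.absNorm]
  simp only [map_pow]
  unfold Finsupp.prod
  push_cast
  rw [jacobiSym_prod_left]
  push_cast
  simp only [jacobiSym.pow_left, Int.cast_pow]

omit [IsCyclotomicExtension {3} ℚ K] in
/-- `idealPow` on an ideal prime to `𝔪` only sees the values off `𝔪` (private copy). [folklore] -/
private theorem idealPow_congr_of_isCoprime'' {𝔪 : Ideal (𝓞 K)} (h𝔪 : 𝔪 ≠ ⊥) {ψ ψ' : HeightOneSpectrum (𝓞 K) → ℂ}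
    (h : ∀ v : HeightOneSpectrum (𝓞 K), ¬ 𝔪 ≤ v.asIdeal → ψ v = ψ' v) {I : Ideal (𝓞 K)} (hI : I ≠ ⊥)
    (hIm : IsCoprime I 𝔪) : idealPow K ψ I = idealPow K ψ' I := by
  unfold idealPow
  refine finprod_congr fun v => ?_
  by_cases hc : (Associates.mk v.asIdeal).count (Associates.mk I).factors = 0
  · rw [hc, pow_zero, pow_zero]
  · have hdvd : v.asIdeal ∣ I := (Associates.count_ne_zero_iff_dvd hI v.irreducible).mp hc
    have hv : ¬ 𝔪 ≤ v.asIdeal := fun hm =>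
      (LFunctions.isCoprime_iff_forall_not_le h𝔪).mp hIm v hm (Ideal.le_of_dvd hdvd)
    rw [h v hv]

omit [IsCyclotomicExtension {3} ℚ K] in
/-- `(ψ₁ψ₂)(𝔞) = ψ₁(𝔞) ψ₂(𝔞)` (private copy). [folklore] -/
private theorem idealPow_mul_fun'' (ψ₁ ψ₂ : HeightOneSpectrum (𝓞 K) → ℂ) {I : Ideal (𝓞 K)} (hI : I ≠ ⊥) :
    idealPow K (fun v => ψ₁ v * ψ₂ v) I = idealPow K ψ₁ I * idealPow K ψ₂ I := by
  unfold idealPow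
  rw [← finprod_mul_distrib (LFunctions.mulSupport_idealPow_finite ψ₁ hI) (LFunctions.mulSupport_idealPow_finite ψ₂ hI)]
  exact finprod_congr fun v => mul_pow _ _ _

omit [NumberField K] [IsCyclotomicExtension {3} ℚ K] in
/-- `(9u) ⊆ (3)`, `(9u) ⊆ (|u|)`, `(9u) ⊆ (3u)`. [folklore] -/
private theorem modulusOdd_le_aux (u : ℤ) :
    modulusOdd (K := K) u ≤ Ideal.span {(3 : 𝓞 K)} ∧ modulusOdd (K := K) u ≤ Ideal.span {((u.natAbs : ℕ) : 𝓞 K)} ∧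
      modulusOdd (K := K) u ≤ Ideal.span {3 * ((u : ℤ) : 𝓞 K)} := by
  refine ⟨Ideal.span_singleton_le_span_singleton.mpr ⟨((3 * u : ℤ) : 𝓞 K), by push_cast; ring⟩,
    Ideal.span_singleton_le_span_singleton.mpr ?_, Ideal.span_singleton_le_span_singleton.mpr ⟨3, by push_cast; ring⟩⟩
  have hz : (u.natAbs : ℤ) ∣ 9 * u := (Int.natAbs_dvd.mpr dvd_rfl).mul_left 9
  have := map_dvd (Int.castRingHom (𝓞 K)) hz
  simpa only [eq_intCast, Int.cast_natCast] using this

/-- ★ **`ψ̃'((b)) = (N(b)/|u|) · S_u((b)) · e(primarize b)`** for nonzero `b` prime to `9u`. [cite: IrelandRosen1990, Ch. 18 §6, proof of Theorem 7] -/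
theorem idealPow_psiOdd_span {u : ℤ} (hu : u ≠ 0) (e : K →+* ℂ) {b : 𝓞 K} (hb : b ≠ 0) (hcop : IsCoprime (Ideal.span {b}) (modulusOdd u)) :
    idealPow K (psiOdd hζ u e) (Ideal.span {b}) =
      (J(Ideal.absNorm (Ideal.span {b}) | u.natAbs) : ℂ) * ((artinSymbol (cubicLoc hζ ((u : ℤ) : 𝓞 K) e) (Ideal.span {b}) : ℂˣ) : ℂ) *
        e (primarize (hsurj_three hζ) b : K) := by
  haveI : IsPrincipalIdealRing (𝓞 K) := IsCyclotomicExtension.Rat.three_pid K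
  have hI : (Ideal.span {b} : Ideal (𝓞 K)) ≠ ⊥ := by rwa [Ne, Ideal.span_singleton_eq_bot]
  obtain ⟨hle3, -, -⟩ := modulusOdd_le_aux (K := K) u
  have h3 : IsCoprime (Ideal.span {b}) (Ideal.span {(3 : 𝓞 K)}) := by
    rw [Ideal.isCoprime_iff_sup_eq] at hcop ⊢; exact top_le_iff.mp (hcop ▸ sup_le_sup_left hle3 _)
  have hS := idealPow_comp_eq (Units.coeHom ℂ) (cubicLoc hζ ((u : ℤ) : 𝓞 K) e) hI
  simp only [Units.coeHom_apply] at hS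
  rw [idealPow_congr_of_isCoprime'' (modulusOdd_ne_bot hu) (fun v hv => psiOdd_of_not_mem hζ e ((modulusOdd_le_iff u v).not.mp hv)) hI hcop,
    idealPow_mul_fun'' _ _ hI, idealPow_mul_fun'' _ _ hI, idealPow_jacobiSym_left u.natAbs hI, hS]
  congr 1
  exact idealPow_primaryGen_span (hsurj_three hζ) (hinj_three hζ) (by rw [Ne, Ideal.span_singleton_eq_bot]; norm_num) e hb h3

/-- ★★ **`ψ'` is a Größencharakter modulo `(9u)` of infinity type `(embType e, embTypeConj e)`** (`u ≠ 0`): the Jacobi factor `(N(b)/|u|)` only depends on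
`N(b) mod |u|` (congruent elements have congruent norms; `jacobiSym.mod_left`), the cubic factor on `b mod 9u`, and one unit primarises `b` and `c`.
[cite: IrelandRosen1990, Ch. 18 §6 Theorem 7] [cite: NeukirchANT1999, Ch. VII §6 Def. (6.1)] -/
theorem isGrossencharakter_psiOdd {u : ℤ} (hu : u ≠ 0) (e : K →+* ℂ) :
    IsGrossencharakter (modulusOdd u) (embType e) (embTypeConj e) (psiOdd hζ u e) := by
  haveI : IsPrincipalIdealRing (𝓞 K) := IsCyclotomicExtension.Rat.three_pid K
  obtain ⟨hle3, hleu, hle3u⟩ := modulusOdd_le_aux (K := K) u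
  have hmono : ∀ {x : 𝓞 K} {J : Ideal (𝓞 K)}, IsCoprime (Ideal.span {x}) (modulusOdd u) → modulusOdd u ≤ J →
      IsCoprime (Ideal.span {x}) J := fun hx hJ => by
    rw [Ideal.isCoprime_iff_sup_eq] at hx ⊢; exact top_le_iff.mp (hx ▸ sup_le_sup_left hJ _)
  refine ⟨fun v hv => psiOdd_ne_zero hζ e ((modulusOdd_le_iff u v).not.mp hv), fun b c hb hc hcop hbc _ => ?_⟩
  have hbcop : IsCoprime (Ideal.span {b}) (modulusOdd u) := isCoprime_span_of_sub_mem hcop hbc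
  rw [idealPow_psiOdd_span hζ hu e hb hbcop, idealPow_psiOdd_span hζ hu e hc hcop, prod_embedding_zpow_embType, map_div₀]
  -- (1) Jacobi factors: `N(b) ≡ N(c) (mod |u|)`
  have hJ : J(Ideal.absNorm (Ideal.span {b}) | u.natAbs) = J(Ideal.absNorm (Ideal.span {c}) | u.natAbs) := by
    rw [jacobiSym.mod_left (Ideal.absNorm (Ideal.span {b}) : ℤ), jacobiSym.mod_left (Ideal.absNorm (Ideal.span {c}) : ℤ),
      ← Int.natCast_mod, ← Int.natCast_mod,
      show Ideal.absNorm (Ideal.span {b}) % u.natAbs = Ideal.absNorm (Ideal.span {c}) % u.natAbs from absNorm_span_modEq (hleu hbc)]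
  -- (2) cubic factors: periodicity modulo `9u`
  have hS : (artinSymbol (cubicLoc hζ ((u : ℤ) : 𝓞 K) e) (Ideal.span {b}) : ℂˣ) =
      artinSymbol (cubicLoc hζ ((u : ℤ) : 𝓞 K) e) (Ideal.span {c}) :=
    artinSymbol_cubicLoc_span_eq_of_sub_mem hζ e hb hc (hmono hcop hle3u) (by
      rw [show (9 : 𝓞 K) * ((u : ℤ) : 𝓞 K) = ((9 * u : ℤ) : 𝓞 K) by push_cast; ring]; exact hbc)
  -- (3) one unit primarises `b` and `c`
  have he : e (primarize (hsurj_three hζ) b : K) * e (c : K) = e (primarize (hsurj_three hζ) c : K) * e (b : K) := by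
    have h := primarize_mul_eq_primarize_mul (hsurj_three hζ) (hinj_three hζ) (hmono hcop hle3) (hle3 hbc)
    have h' : (primarize (hsurj_three hζ) b : K) * (c : K) = (primarize (hsurj_three hζ) c : K) * (b : K) := by
      exact_mod_cast congrArg (fun x : 𝓞 K => (x : K)) h
    rw [← map_mul e, ← map_mul e, h']
  have hc0 : e (c : K) ≠ 0 := by rw [map_ne_zero]; exact_mod_cast hc
  rw [hJ, hS, mul_div_assoc', eq_div_iff hc0]
  linear_combination ((J(Ideal.absNorm (Ideal.span {c}) | u.natAbs) : ℂ) *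
    ((artinSymbol (cubicLoc hζ ((u : ℤ) : 𝓞 K) e) (Ideal.span {c}) : ℂˣ) : ℂ)) * he

/-- For `e` the embedding of an infinite place `w₀` (the only one), `embType e ≡ 1`, `embTypeConj e ≡ 0`. [cite: SilvermanATAEC1994, II Thm. 9.2 (a)] -/
private theorem embType_embedding_eq' (w₀ : InfinitePlace K) :
    embType w₀.embedding = (fun _ : InfinitePlace K => (1 : ℤ)) ∧ embTypeConj w₀.embedding = (fun _ : InfinitePlace K => (0 : ℤ)) := by
  haveI := subsingleton_infinitePlace (K := K)
  constructor
  · funext w; rw [Subsingleton.elim w w₀, embType, if_pos rfl]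
  · funext w; rw [Subsingleton.elim w w₀, embTypeConj, if_pos rfl]

/-- ★★ **The literal type-`(1, 0)` form**: `IsGrossencharakter (9u) (fun _ ↦ 1) (fun _ ↦ 0) ψ'` for `e` the embedding of the (unique) infinite place.
[cite: SilvermanATAEC1994, II Thm. 9.2 (a)] [cite: IrelandRosen1990, Ch. 18 §6 Theorem 7] -/
theorem isGrossencharakter_psiOdd_one_zero {u : ℤ} (hu : u ≠ 0) (w₀ : InfinitePlace K) :
    IsGrossencharakter (modulusOdd u) (fun _ => 1) (fun _ => 0) (psiOdd hζ u w₀.embedding) := by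
  obtain ⟨h1, h2⟩ := embType_embedding_eq' (K := K) w₀
  rw [← h1, ← h2]
  exact isGrossencharakter_psiOdd hζ hu w₀.embedding

/-- ★ **`ψ'(c • 𝔭) = conj ψ'(𝔭)` for every prime.** [cite: IrelandRosen1990, Ch. 18 §6, proof of Theorem 7 (`χ(Ā) = \overline{χ(A)}`)] [cite: SilvermanATAEC1994, II Thm. 10.5] -/
theorem psiOdd_smul_eq_conj {u : ℤ} (e : K →+* ℂ) {c : K ≃ₐ[ℚ] K} (hc : c ≠ 1) (v : HeightOneSpectrum (𝓞 K)) :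
    psiOdd hζ u e (c • v) = conj (psiOdd hζ u e v) := by
  by_cases h : ((3 * u : ℤ) : 𝓞 K) ∈ v.asIdeal
  · rw [psiOdd_of_mem hζ e h, psiOdd_of_mem hζ e ((intCast_mem_smul_iff c v _).mpr h), map_zero]
  · obtain ⟨h3, huv⟩ := not_mem_of_three_mul_not_mem h
    have h' : ((3 * u : ℤ) : 𝓞 K) ∉ (c • v).asIdeal := fun hm => h ((intCast_mem_smul_iff c v _).mp hm)
    rw [psiOdd_of_not_mem hζ e h, psiOdd_of_not_mem hζ e h', map_mul, map_mul, map_intCast,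
      Literature.NumberTheory.Automorphic.HeightOneSpectrum.smul_asIdeal, absNorm_smul,
      coe_cubicLoc_smul hζ e hc (smul_intCast c _) huv h3, embedding_varpi_smul hζ e hc h3]

end PsiOdd

end Literature.NumberTheory.GaloisRepresentations.EisensteinSextic

end
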